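import Summits.MatrixMultiplication.MatrixMultiplication.Theorems.SoloBlindTwist

/-!
# The twist tower: (K₃) and zero-sum-freeness on every iterated twist; the binary lifts in every rank

Sub-programme (K₃), continuation of `SoloBlindTwist`.  A configuration is bundled as `SoloBlindCfg` (index type,
group, map, index set, shift); `SoloBlindCfg.twist` is one twist step (`soloBlindTwist` into `G × ZMod 3`, shift
`(a, 0)`), `SoloBlindCfg.iterTwist m` the `m`-fold twist.  Since every twisted mass is an average of masses one
step down (`soloBlind_twist_kraft`), (K₃) CLIMBS THE WHOLE TOWER (`soloBlind_tower_kraft`): if `K ≤ 1` at every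
target of a configuration then `K ≤ 1` at every target of each of its iterated twists, in every rank; zero-sum-
freeness climbs too (`soloBlind_tower_zsf`).  Starting from the singleton `{a}`, `a ≠ 0`
(`soloBlindSingletonCfg`), whose iterated twists are the BINARY LIFTS `{a} ∪ {b_i, b_i + a : i < m}` of the tight
census, this gives (K₃) ON EVERY BINARY LIFT IN EVERY RANK (`soloBlind_binaryLift_kraft`) — the infinite all-rank
family on which Conjecture E is tight with no small members (`SoloBlindBinaryLift`, ranks 5, 6, 8 by `decide`).
No instance is declared: the bundled instances are activated locally with `letI`.
-/

namespace Summit.MatrixMultiplication.MatrixMultiplication.Theorems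

open Finset

universe w

/-- A bundled configuration: indices `ι`, group `G`, map `h`, index set `S`, shift `a` (instances as fields). -/
structure SoloBlindCfg : Type (w + 1) where
  /-- index type -/
  ι : Type w
  /-- the group -/
  G : Type w
  /-- decidable equality of indices -/
  instDecι : DecidableEq ι
  /-- group structure -/
  instGrp : AddCommGroup G
  /-- decidable equality in the group -/
  instDecG : DecidableEq G
  /-- the map -/
  h : ι → G
  /-- the index set -/
  S : Finset ι
  /-- the shift of the twists -/
  a : G

namespace SoloBlindCfg

/-- (K₃) for a configuration: `K(σ; S) ≤ 1` at every target. -/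
def kraft (c : SoloBlindCfg.{w}) : Prop :=
  letI := c.instGrp; letI := c.instDecG
  ∀ σ : c.G, soloBlindMass c.h c.S σ ≤ 1

/-- Zero-sum-freeness of a configuration. -/
def zsf (c : SoloBlindCfg.{w}) : Prop :=
  letI := c.instGrp
  ∀ T ⊆ c.S, T.Nonempty → ∑ i ∈ T, c.h i ≠ 0

/-- Exponent `3`. -/
def three (c : SoloBlindCfg.{w}) : Prop :=
  letI := c.instGrp
  ∀ g : c.G, g + g + g = 0

/-- One twist step: into `G × ZMod 3`, adjoining `(0, 1)` and `(a, 1)`; the shift becomes `(a, 0)`. -/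
def twist (c : SoloBlindCfg.{w}) : SoloBlindCfg.{w} :=
  letI := c.instDecι; letI := c.instGrp; letI := c.instDecG
  { ι := Option (Option c.ι)
    G := c.G × ZMod 3
    instDecι := inferInstance
    instGrp := inferInstance
    instDecG := inferInstance
    h := soloBlindTwist c.h c.a
    S := insertNone (insertNone c.S)
    a := (c.a, 0) }

/-- The `m`-fold twist. -/
def iterTwist : ℕ → SoloBlindCfg.{w} → SoloBlindCfg.{w}
  | 0, c => c
  | m + 1, c => (iterTwist m c).twist

/-- (K₃) survives one twist step (`soloBlind_twist_kraft`). -/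
theorem twist_kraft (c : SoloBlindCfg.{w}) (hK : c.kraft) : c.twist.kraft := by
  letI := c.instDecι; letI := c.instGrp; letI := c.instDecG
  intro t
  exact soloBlind_twist_kraft c.h c.S c.a hK t

/-- Exponent `3` survives one twist step. -/
theorem twist_three (c : SoloBlindCfg.{w}) (h3 : c.three) : c.twist.three := by
  letI := c.instDecι; letI := c.instGrp; letI := c.instDecG
  intro g
  exact soloBlind_cone_three h3 g

/-- Zero-sum-freeness survives one twist step (`soloBlind_twist_zsf`). -/
theorem twist_zsf (c : SoloBlindCfg.{w}) (h3 : c.three) (hz : c.zsf) : c.twist.zsf := by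
  letI := c.instDecι; letI := c.instGrp; letI := c.instDecG
  intro T hT hne
  exact soloBlind_twist_zsf h3 c.a hz T hT hne

end SoloBlindCfg

/-- (K₃) CLIMBS THE TOWER: `K ≤ 1` at every target of a configuration gives `K ≤ 1` at every target of each
iterated twist. -/
theorem soloBlind_tower_kraft (c : SoloBlindCfg.{w}) (hK : c.kraft) (m : ℕ) : (c.iterTwist m).kraft := by
  induction m with
  | zero => exact hK
  | succ m ih => exact SoloBlindCfg.twist_kraft _ ih

/-- Exponent `3` climbs the tower. -/
theorem soloBlind_tower_three (c : SoloBlindCfg.{w}) (h3 : c.three) (m : ℕ) : (c.iterTwist m).three := by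
  induction m with
  | zero => exact h3
  | succ m ih => exact SoloBlindCfg.twist_three _ ih

/-- Zero-sum-freeness climbs the tower. -/
theorem soloBlind_tower_zsf (c : SoloBlindCfg.{w}) (h3 : c.three) (hz : c.zsf) (m : ℕ) :
    (c.iterTwist m).zsf := by
  induction m with
  | zero => exact hz
  | succ m ih => exact SoloBlindCfg.twist_zsf _ (soloBlind_tower_three c h3 m) ih

/-! ### The singleton `{a}` and the binary lifts -/

section Singleton

variable {G : Type w} [AddCommGroup G] [DecidableEq G]

/-- Masses on the empty index set: only the target `0` is represented (by `∅`). -/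
theorem soloBlind_mass_empty {ι : Type w} (h : ι → G) (x : G) :
    soloBlindMass h (∅ : Finset ι) x = if x = 0 then 1 else 0 := by
  rw [soloBlindMass, soloBlindSeqRepAll, Finset.powerset_empty, Finset.filter_singleton, Finset.sum_empty]
  by_cases hx : x = 0
  · rw [if_pos hx.symm, if_pos hx, Finset.sum_singleton, Finset.card_empty, pow_zero]
  · rw [if_neg (Ne.symm hx), if_neg hx, Finset.sum_empty]

/-- Masses of the singleton configuration `u ↦ a`, `a ≠ 0`, are at most `1`. -/
theorem soloBlind_mass_singleton_le (a : G) (ha : a ≠ 0) (σ : G) :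
    soloBlindMass (fun _ : PUnit.{w + 1} => a) {PUnit.unit} σ ≤ 1 := by
  rw [soloBlind_mass_erase (fun _ : PUnit.{w + 1} => a) (Finset.mem_singleton_self PUnit.unit) σ,
    Finset.erase_singleton, soloBlind_mass_empty, soloBlind_mass_empty]
  by_cases h0 : σ = 0
  · have h1 : ¬ (σ - a = 0) := by
      rw [h0, zero_sub, neg_eq_zero]
      exact ha
    rw [if_pos h0, if_neg h1]
    norm_num
  · rw [if_neg h0]
    split_ifs <;> norm_num

/-- The singleton configuration `{a}` in `G` with shift `a`. -/
def soloBlindSingletonCfg (G : Type w) [AddCommGroup G] [DecidableEq G] (a : G) : SoloBlindCfg.{w} :=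
  { ι := PUnit.{w + 1}
    G := G
    instDecι := inferInstance
    instGrp := inferInstance
    instDecG := inferInstance
    h := fun _ => a
    S := {PUnit.unit}
    a := a }

/-- The binary lift `{a} ∪ {b_i, b_i + a : i < m}`: the `m`-fold twist of the singleton `{a}`. -/
def soloBlindBinaryLiftCfg (G : Type w) [AddCommGroup G] [DecidableEq G] (a : G) (m : ℕ) :
    SoloBlindCfg.{w} :=
  (soloBlindSingletonCfg G a).iterTwist m

/-- (K₃) ON EVERY BINARY LIFT, IN EVERY RANK: for `a ≠ 0`, every target of the `m`-fold binary lift of `{a}` has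
Kraft mass at most `1`. -/
theorem soloBlind_binaryLift_kraft (a : G) (ha : a ≠ 0) (m : ℕ) :
    (soloBlindBinaryLiftCfg G a m).kraft := by
  unfold soloBlindBinaryLiftCfg
  refine soloBlind_tower_kraft (soloBlindSingletonCfg G a) (fun σ => ?_) m
  exact soloBlind_mass_singleton_le a ha σ

omit [DecidableEq G] in
/-- The singleton configuration `u ↦ a`, `a ≠ 0`, is zero-sum free. -/
theorem soloBlind_singleton_zsf (a : G) (ha : a ≠ 0) :
    ∀ T ⊆ ({PUnit.unit} : Finset PUnit.{w + 1}), T.Nonempty → ∑ _i ∈ T, a ≠ 0 := by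
  intro T hT hne hsum
  rw [Finset.sum_const] at hsum
  rw [← Finset.card_pos] at hne
  have hT1 : T.card ≤ 1 :=
    le_trans (Finset.card_le_card hT) (by rw [Finset.card_singleton])
  have hc : T.card = 1 := le_antisymm hT1 hne
  rw [hc, one_smul] at hsum
  exact ha hsum

/-- The binary lifts are zero-sum free (exponent-`3` group, `a ≠ 0`). -/
theorem soloBlind_binaryLift_zsf (three : ∀ g : G, g + g + g = 0) (a : G) (ha : a ≠ 0) (m : ℕ) :
    (soloBlindBinaryLiftCfg G a m).zsf := by
  unfold soloBlindBinaryLiftCfg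
  exact soloBlind_tower_zsf (soloBlindSingletonCfg G a) (fun g => three g) (soloBlind_singleton_zsf a ha) m

end Singleton

end Summit.MatrixMultiplication.MatrixMultiplication.Theorems
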